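import Mathlib
import HarnessLib
import Literature.Computability.MetaComplexity.NCIPS

/-!
# Crux `RankDefectRepresentations` (stmt-PneNP-18923), line `phantom-kernel`: stub S3 `stub_diagonal` (DIAGONAL)

Registered tool stub S3 of the skeleton `Cruxes/RankDefectRepresentations/Lines/phantom_kernel.lean` (lead prover,
2026-08-27).  The crux asks for ONE CNF family `φ : (n : ℕ) → CNF (Fin n)` good for every exponent `c`
(`∃ φ ∀ c ∀ᶠ n …`), while the line produces witnesses per `(c, n)` under a size bound `p` UNIFORM in `c`
(`∀ c ∀ᶠ n ∃ φ …`).  The swap is a diagonal choice: thresholds from `Filter.eventually_atTop`, a growth function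
`g n → ∞` with "eventually, the witnesses exist at `n` for all `c ≤ g n`" (`exists_diag_phantom`), `φ n :=` the witness
at `(g n, n)`, padded by the one-empty-clause CNF `[[]]` below the threshold, `p' := p + 1`.  Same device as
`exists_diag` / `rankDefectRepresentations_iff_pointwise` of the sibling skeleton `Lines/rank_dehn_ladder.lean`
(planner cruxplan-18923-rank-dehn-ladder), with the phantom-kernel dimension in place of the clause-product rank.
HONEST FRAMING: bookkeeping; P ≠ NP is not moved; F-N2 is a FRONTIER formal rung.
-/

set_option linter.dupNamespace false -- `Summit.PneNP.PneNP.…`: summit = sub-problem name (D-0017)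

namespace Summit.PneNP.PneNP.Theorems.CnfIdealGenLengthRankDefectRepresentationsDiagonal

open Filter
open Literature.Computability.Complexity
open Literature.Computability.MetaComplexity
open Literature.Computability.MetaComplexity.NCIPS

/-- Diagonal extraction: from "for every `c`, eventually `P c n`" a growth function `g` (eventually above every
`c`) with "eventually, `P c n` for all `c ≤ g n`". [folklore] -/
theorem exists_diag_phantom {P : ℕ → ℕ → Prop} (h : ∀ c, ∀ᶠ n in atTop, P c n) :
    ∃ g : ℕ → ℕ, (∀ c, ∀ᶠ n in atTop, c ≤ g n) ∧ ∀ᶠ n in atTop, ∀ c ≤ g n, P c n := by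
  have hQ : ∀ c, ∀ᶠ n in atTop, ∀ c' ≤ c, P c' n := by
    intro c
    induction c with
    | zero =>
      filter_upwards [h 0] with n hn c' hc'
      rwa [Nat.le_zero.mp hc']
    | succ c ih =>
      filter_upwards [ih, h (c + 1)] with n hn hn1 c' hc'
      by_cases hc : c' ≤ c
      · exact hn c' hc
      · have : c' = c + 1 := by omega
        subst this; exact hn1
  choose N hN using fun c => eventually_atTop.mp (hQ c)
  refine ⟨fun n => Nat.findGreatest (fun c => N c ≤ n) n, fun c => ?_, ?_⟩
  · filter_upwards [eventually_ge_atTop (max c (N c))] with n hn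
    exact Nat.le_findGreatest (le_of_max_le_left hn) (le_of_max_le_right hn)
  · filter_upwards [eventually_ge_atTop (N 0)] with n hn c hc
    have hspec : N (Nat.findGreatest (fun c => N c ≤ n) n) ≤ n :=
      Nat.findGreatest_spec (P := fun c => N c ≤ n) (Nat.zero_le n) hn
    exact hN _ n hspec c hc

/-- STUB S3 `stub_diagonal` of the line `phantom-kernel` (registered signature, verbatim): per-exponent phantom
witnesses under a size bound UNIFORM in the exponent give one CNF family good for every exponent. [folklore] -/
theorem stub_diagonal :
    ∀ p : Polynomial ℕ,
      (∀ c : ℕ, ∀ᶠ n : ℕ in atTop, ∃ φ : CNF (Fin n),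
        (¬ φ.Satisfiable ∧ CNF.numClauses φ ≤ p.eval n ∧ CNF.size φ ≤ p.eval n) ∧
        ∃ (K : Type) (_ : Field K) (_ : CharZero K) (d t : ℕ) (M : Fin n → Matrix (Fin d) (Fin d) K),
          (∀ g : MonoidAlgebra K (FreeMonoid (Fin n)), IsAxiom g →
            (MonoidAlgebra.lift K (Matrix (Fin d) (Fin d) K) (FreeMonoid (Fin n)) (FreeMonoid.lift M)
              g).rank ≤ t) ∧
          n ^ c * t < Module.finrank K (⨅ κ ∈ φ, LinearMap.ker (Matrix.toLin'
            (MonoidAlgebra.lift K (Matrix (Fin d) (Fin d) K) (FreeMonoid (Fin n)) (FreeMonoid.lift M)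
              (clauseWord K κ))) : Submodule K (Fin d → K))) →
      ∃ p' : Polynomial ℕ, ∃ φ : (n : ℕ) → CNF (Fin n),
        (∀ n, ¬ (φ n).Satisfiable ∧ CNF.numClauses (φ n) ≤ p'.eval n ∧ CNF.size (φ n) ≤ p'.eval n) ∧
        ∀ c : ℕ, ∀ᶠ n : ℕ in atTop, ∃ (K : Type) (_ : Field K) (_ : CharZero K) (d t : ℕ)
          (M : Fin n → Matrix (Fin d) (Fin d) K),
          (∀ g : MonoidAlgebra K (FreeMonoid (Fin n)), IsAxiom g →
            (MonoidAlgebra.lift K (Matrix (Fin d) (Fin d) K) (FreeMonoid (Fin n)) (FreeMonoid.lift M)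
              g).rank ≤ t) ∧
          n ^ c * t < Module.finrank K (⨅ κ ∈ φ n, LinearMap.ker (Matrix.toLin'
            (MonoidAlgebra.lift K (Matrix (Fin d) (Fin d) K) (FreeMonoid (Fin n)) (FreeMonoid.lift M)
              (clauseWord K κ))) : Submodule K (Fin d → K)) := by
  intro p hp
  classical
  obtain ⟨g, hg, hP⟩ := exists_diag_phantom hp
  -- the witness predicate at `(c, n)`
  let Q : ℕ → Prop := fun n => ∃ φ : CNF (Fin n),
    (¬ φ.Satisfiable ∧ CNF.numClauses φ ≤ p.eval n ∧ CNF.size φ ≤ p.eval n) ∧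
      ∃ (K : Type) (_ : Field K) (_ : CharZero K) (d t : ℕ) (M : Fin n → Matrix (Fin d) (Fin d) K),
        (∀ g : MonoidAlgebra K (FreeMonoid (Fin n)), IsAxiom g →
          (MonoidAlgebra.lift K (Matrix (Fin d) (Fin d) K) (FreeMonoid (Fin n)) (FreeMonoid.lift M)
            g).rank ≤ t) ∧
        n ^ g n * t < Module.finrank K (⨅ κ ∈ φ, LinearMap.ker (Matrix.toLin'
          (MonoidAlgebra.lift K (Matrix (Fin d) (Fin d) K) (FreeMonoid (Fin n)) (FreeMonoid.lift M)
            (clauseWord K κ))) : Submodule K (Fin d → K))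
  have hQ : ∀ᶠ n in atTop, Q n := hP.mono fun n hn => hn (g n) le_rfl
  let fam : (n : ℕ) → CNF (Fin n) := fun n => if hq : Q n then Classical.choose hq else [[]]
  refine ⟨p + 1, fam, fun n => ?_, fun c => ?_⟩
  · by_cases hq : Q n
    · obtain ⟨⟨h1, h2, h3⟩, -⟩ := Classical.choose_spec hq
      simp only [fam, dif_pos hq, Polynomial.eval_add, Polynomial.eval_one]
      exact ⟨h1, by omega, by omega⟩
    · simp only [fam, dif_neg hq, Polynomial.eval_add, Polynomial.eval_one]
      refine ⟨CNF.not_satisfiable_of_nil_mem (List.mem_singleton_self _), ?_, ?_⟩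
      · simp [CNF.numClauses]
      · simp [CNF.size]
  · filter_upwards [hg c, hQ, eventually_ge_atTop 1] with n hcg hq hn1
    obtain ⟨-, K, iF, iC, d, t, M, hM, hlt⟩ := Classical.choose_spec hq
    have hfam : fam n = Classical.choose hq := dif_pos hq
    rw [hfam]
    refine ⟨K, iF, iC, d, t, M, hM, lt_of_le_of_lt ?_ hlt⟩
    exact Nat.mul_le_mul_right t (Nat.pow_le_pow_right hn1 hcg)

end Summit.PneNP.PneNP.Theorems.CnfIdealGenLengthRankDefectRepresentationsDiagonal
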